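import Literature.Probability.Percolation.MarkedLoopBraidRotation
import Literature.Probability.Percolation.MarkedLoopTripodCharacter
import HarnessLib

/-!
# The Temperley–Lieb braid on the link basis: conjugacy to the mark rotation, trivial full twist, vanishing character («TRIPOD-BRAID-TWIST»)

Topic `Literature/Probability/Percolation`; generic-`k` layer, a rider on `MarkedLoopBraidRotation.lean` («TRIPOD-BRAID»: for every tripod-law solution
`w` and outermost pattern `q`, `(w ∘ patMap rot)(q) = (−τ)·w(gonNext q) + (−τ²)·w(gonCap q)`, where under `closeUp` the map `gonNext` is the rotation of
the `(k+1)`-gon and `gonCap` is the Temperley–Lieb generator `e_{*,0}` of it) and on `MarkedLoopTripodCharacter.lean` («TRIPOD-REP»: the powers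
`rotOp k r` of the mark rotation on `solW k`, `rotOp_succ`, `rotOp_self_eq_zero'`, and the character `trace_solWRot_pow_eq_zero` /
`trace_solWRot_third_eq`).

THIS FILE makes the braid an honest linear operator on the link coordinates `Pat₀ k → ℂ` and transfers the lane's theorems to it:
* `braidLin` — THE TEMPERLEY–LIEB BRAID OPERATOR `B φ (q) = A⁻¹·φ(gonNext q) + A·φ(gonCap q)` (`A = −τ²`, `A⁻¹ = −τ`), i.e. `ρᵀ ∘ (A⁻¹·1 + A·e_{*,0})ᵀ` in
  the link basis of the `(k+1)`-gon;
* ★★ `braidLin_solWEquiv`, `braidLin_eq_conj`, `braidLin_pow` — CONJUGACY: `B = solWEquiv ∘ R₁ ∘ solWEquiv⁻¹` and `B^m = solWEquiv ∘ R_m ∘ solWEquiv⁻¹`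
  (`R_m = rotOp k m`): the mark rotation of Khristoforov–Smirnov's tripod-law solutions IS the Temperley–Lieb braid on the link basis;
* ★★★ `braidLin_pow_marks` — **THE FULL TWIST IS TRIVIAL: `B^k = 1`** — the `k`-th power of the Temperley–Lieb braid `A⁻¹ρ + A·e_{*,0}ρ` on the
  `C_{(k+1)/2}`-dimensional link space of the `(k+1)`-gon is the identity at loop weight one (the periodic braid `σ_{*,0}δ` of `B_{k+1}` has
  `(σδ)^k = Δ²`, so this is the statement that the full twist acts trivially in this Temperley–Lieb representation at `t = e^{2πi/3}`); obtained for
  free from `rot^k = id` on patterns;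
* ★★ `trace_braidLin_pow_eq_zero` — for `3 ∤ k` THE CHARACTER OF THE BRAID VANISHES OFF MULTIPLES OF `k`: `tr B^r = 0` (`k ∤ r`) — REP's
  `trace_solWRot_pow_eq_zero` read on the link basis; ★ `trace_braidLin_pow_third` — for `k = 3r` the value `tr B^r = −τ²·#{invariant triangle
  pictures}` (REP's `trace_solWRot_third_eq`); `trace_braidLin_pow_marks` (`tr B^k = tr 1 = dim`).

Status in print: as for the parent file (the braid-generator form `A^{∓1} + A^{±1}e` and the skein constants are Kauffman's; the statements about
Khristoforov–Smirnov's solution space are the lane's; the identification was not located in print, lane literature desk 2026-08-26).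

## References
* M. Khristoforov, S. Smirnov, *Percolation and O(1) loop model*, arXiv:2111.15612 (2021), §1.2 (arXiv v1 p. 2), §2 Definition 3, Lemma 4, Fig. 3 (p. 4).
* L. H. Kauffman, *Knots and Physics*, World Scientific (1991), Part I §3 (Cor. 3.4, Prop. 3.5) and §7 (`ρ(σ_i) = A + A⁻¹U_i`, Prop. 7.4 / 7.5).

## Mathlib / tree
Tree: `MarkedLoopBraidRotation.lean` (`gonNext`, `gonCap`, `solWEquiv_solWRot`), `MarkedLoopTripodCharacter.lean` (`rotOp`, `rotOp_apply`, `rotOp_succ`,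
`rotOp_zero`, `rotOp_self_eq_zero'`, `patMap_congr`, `trace_solWRot_pow_eq_zero`, `trace_solWRot_third_eq`), `MarkedLoopTripodBasis.lean` (`solWEquiv`,
`solWEquiv_apply`, `finrank_solW`). Mathlib: `LinearEquiv.conj`, `LinearEquiv.conj_apply_apply`, `LinearEquiv.conj_comp`, `LinearEquiv.conj_id`,
`LinearMap.trace_conj'`, `LinearMap.trace_one`.
-/

open Finset

namespace Literature.Probability.Percolation.MarkedLoops

open Literature.Probability.Percolation.FivePoint (tau)

section Twist

variable {n : ℕ}

/-- ★ **THE TEMPERLEY–LIEB BRAID OPERATOR ON THE LINK COORDINATES**: `(B φ)(q) = (−τ)·φ(gonNext q) + (−τ²)·φ(gonCap q)` — `A⁻¹` times the polygon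
rotation plus `A` times its capped version, `A = −τ²`. [cite: Kauffman1991KnotsPhysics, Part I §7 Prop. 7.5 (ρ(σ_i) = A + A⁻¹U_i); KhristoforovSmirnov2021, §1.2 (arXiv v1 p. 2: cyclic indexing)] -/
noncomputable def braidLin : (Pat₀ (n + 1) → ℂ) →ₗ[ℂ] (Pat₀ (n + 1) → ℂ) where
  toFun φ q := (-tau) * φ (gonNext q) + (-tau ^ 2) * φ (gonCap q)
  map_add' φ ψ := by
    funext q
    simp only [Pi.add_apply]
    ring
  map_smul' c φ := by
    funext q
    simp only [Pi.smul_apply, smul_eq_mul, RingHom.id_apply]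
    ring

/-- the braid operator evaluated. [cite: KhristoforovSmirnov2021, §1.2 (arXiv v1 p. 2)] -/
theorem braidLin_apply (φ : Pat₀ (n + 1) → ℂ) (q : Pat₀ (n + 1)) :
    braidLin φ q = (-tau) * φ (gonNext q) + (-tau ^ 2) * φ (gonCap q) := rfl

/-- ★★ **CONJUGACY, pointwise**: `B (solWEquiv w) = solWEquiv (R₁ w)` — the braid operator on the link coordinates of a tripod-law solution is the
link coordinates of the rotated solution. [cite: KhristoforovSmirnov2021, §2 Lemma 4 (arXiv v1 p. 4); §1.2 (p. 2: cyclic indexing)] -/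
theorem braidLin_solWEquiv (w : solW (n + 1)) : braidLin (solWEquiv (n + 1) w) = solWEquiv (n + 1) (rotOp (n + 1) 1 w) := by
  funext q
  rw [braidLin_apply, ← solWEquiv_solWRot, solWEquiv_apply, solWEquiv_apply, solWRot_apply, rotOp_apply]
  exact congrArg w.1 (patMap_congr _ _ (pow_one _).symm _)

/-- ★★ **CONJUGACY**: `B = solWEquiv ∘ R₁ ∘ solWEquiv⁻¹` — THE MARK ROTATION OF THE TRIPOD-LAW SOLUTIONS IS THE TEMPERLEY–LIEB BRAID ON THE LINK BASIS.
[cite: KhristoforovSmirnov2021, §2 Lemma 4 (arXiv v1 p. 4); §1.2 (p. 2: cyclic indexing)] -/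
theorem braidLin_eq_conj : (braidLin : Module.End ℂ (Pat₀ (n + 1) → ℂ)) = (solWEquiv (n + 1)).conj (rotOp (n + 1) 1) := by
  apply LinearMap.ext
  intro φ
  rw [LinearEquiv.conj_apply_apply]
  conv_lhs => rw [← (solWEquiv (n + 1)).apply_symm_apply φ]
  exact braidLin_solWEquiv _

/-- ★★ **the powers of the braid are conjugate to the powers of the mark rotation**: `B^m = solWEquiv ∘ R_m ∘ solWEquiv⁻¹`.
[cite: KhristoforovSmirnov2021, §2 Lemma 4 (arXiv v1 p. 4); §1.2 (p. 2: cyclic indexing)] -/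
theorem braidLin_pow (m : ℕ) : (braidLin : Module.End ℂ (Pat₀ (n + 1) → ℂ)) ^ m = (solWEquiv (n + 1)).conj (rotOp (n + 1) m) := by
  induction m with
  | zero => rw [pow_zero, rotOp_zero, LinearEquiv.conj_id]; rfl
  | succ m ih => rw [pow_succ', ih, rotOp_succ, LinearEquiv.conj_comp, braidLin_eq_conj]; rfl

/-- ★★★ **THE FULL TWIST IS TRIVIAL: `B^k = 1`** (`k = n+1` marks) — the `k`-th power of the Temperley–Lieb braid `A⁻¹ρ + A·e_{*,0}ρ` on the link space of
the `(k+1)`-gon is the identity at loop weight one. [cite: Kauffman1991KnotsPhysics, Part I §7 Prop. 7.5; KhristoforovSmirnov2021, §1.2 (arXiv v1 p. 2: cyclic indexing)] -/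
theorem braidLin_pow_marks : (braidLin : Module.End ℂ (Pat₀ (n + 1) → ℂ)) ^ (n + 1) = 1 := by
  rw [braidLin_pow, rotOp_self_eq_zero', rotOp_zero, LinearEquiv.conj_id]; rfl

/-- the full twist, applied: `B^[k] φ = φ`. [cite: KhristoforovSmirnov2021, §1.2 (arXiv v1 p. 2: cyclic indexing)] -/
theorem braidLin_iterate_marks (φ : Pat₀ (n + 1) → ℂ) : (braidLin : Module.End ℂ (Pat₀ (n + 1) → ℂ))^[n + 1] φ = φ := by
  have h := congrArg (fun f : Module.End ℂ (Pat₀ (n + 1) → ℂ) => f φ) (braidLin_pow_marks (n := n))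
  simp only [Module.End.pow_apply, Module.End.one_apply] at h
  exact h

/-- ★★ **THE CHARACTER OF THE TEMPERLEY–LIEB BRAID VANISHES OFF MULTIPLES OF `k` when `3 ∤ k`**: `tr B^r = 0` for `k ∤ r` (REP's character theorem on
the link basis). [cite: KhristoforovSmirnov2021, §2 Lemma 4 (arXiv v1 p. 4); §1.2 (p. 2: cyclic indexing)] -/
theorem trace_braidLin_pow_eq_zero (h3 : Nat.Coprime 3 (n + 1)) {r : ℕ} (hr : ¬ (n + 1) ∣ r) :
    LinearMap.trace ℂ (Pat₀ (n + 1) → ℂ) ((braidLin : Module.End ℂ (Pat₀ (n + 1) → ℂ)) ^ r) = 0 := by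
  rw [braidLin_pow, LinearMap.trace_conj']
  exact trace_solWRot_pow_eq_zero h3 hr

/-- ★ **for `3 ∣ k = 3r` the character at `B^r` is `−τ²·#{invariant triangle pictures}`** (REP's value on the link basis).
[cite: KhristoforovSmirnov2021, §2 Lemma 4 and Fig. 3 (arXiv v1 p. 4); §1.2 (p. 2: cyclic indexing)] -/
theorem trace_braidLin_pow_third [DecidableEq (Pic (n + 1))] {r : ℕ} (hr : 3 * r = n + 1) (hpos : 0 < r) :
    LinearMap.trace ℂ (Pat₀ (n + 1) → ℂ) ((braidLin : Module.End ℂ (Pat₀ (n + 1) → ℂ)) ^ r) =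
      -(tau ^ 2 * ((Finset.univ.filter fun P : Pic (n + 1) => Pic.shift (isCyc_rot_pow r) P = P).card : ℂ)) := by
  rw [braidLin_pow, LinearMap.trace_conj']
  exact trace_solWRot_third_eq hr hpos

/-- the character at the full twist is the dimension (`= #Pat₀ k = C_{(k+1)/2}`). [cite: KhristoforovSmirnov2021, §1.2 (arXiv v1 p. 2)] -/
theorem trace_braidLin_pow_marks :
    LinearMap.trace ℂ (Pat₀ (n + 1) → ℂ) ((braidLin : Module.End ℂ (Pat₀ (n + 1) → ℂ)) ^ (n + 1)) = Fintype.card (Pat₀ (n + 1)) := by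
  rw [braidLin_pow_marks, LinearMap.trace_one, Module.finrank_fintype_fun_eq_card]

end Twist

end Literature.Probability.Percolation.MarkedLoops
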